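import Summits.ABC.StewartYu.ArchG3PackClosedHalf
import Summits.ABC.StewartYu.ArchG3SatData
import HarnessLib

/-!
# Cell abc-stewartyu, rung A1.L (crux r2 `ArchCoreRat`), WP-L.A under R34: the VIRTUAL (α-charged) instances of the denominator-generic
# k-step / half-step record packages at `S(θ)` — closed forms from `ArchG3SatData`, one inequality each

`Summits/ABC/StewartYu/ArchG3PackClosedV.lean` — sequel to `ArchG3PackClosed` / `ArchG3PackClosedHalf` (the `N = 1` / θ-charged closed forms)
and `ArchG3SatData` (virtual coordinates) (cell `abc-stewartyu`, HOME `run/shared/lean/pub/abc-stewartyu/`; plan RULINGS R34, «R34 IMPLEMENTATION»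
(α)/(β), lp-1's D-generic vehicle 17:44:32Z; seat p5 g8).  Definitions (`MtV`) and theorems on `ArchG3Setup`; no named fact, no record.

At `S(θ)` (one-stage line, R32 (a)) with saturation datum `F : S.SatData` and virtual box `Bv` (`V w := ∀ j, |ν(w)ⱼ| ≤ Bvⱼ`):
* the k-step monomial denominator is `Dm x := F.Dmv Bv x` (`SatData.exists_int_Dmv_mul_prod` = the pack's `hmon`), so the record's k-step line
  reads `… < 1/(ν(H)^a · Dmv Bv x₁)`, cost `log Dmv ≤ 2|x₁|·Σ(Bvⱼ/N)Vⱼ + 2ΣVⱼ` (N-free);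
* the half-step termwise denominator is `Dh a s := ν(H)^a · F.Dhv Bv s` (**`SatData.exists_int_lcm_pow_mul_Dhv_mul`** = the pack's V-quantified
  `hint`), and the termwise size under the SLAB quantifier `|Lsum w| ≤ γb + w₀` is **`MtV`** `= WC H (ex+1) L₀ T′ N₁ · exp((γb+w₀)·N₁ + ΣAₖ/2)`
  (**`abs_hasse_mul_qEhZ_le_MtV`**, from `ArchG3HalfSupply.abs_hasse_mul_qEhZ_le_slab`; coordinate-free, F = 1, plan (α));
* `SatData.vecMul_U_injective` (`ν` injective — the `hνinj` of p4's `ArchLvInv.frameOutputReal_sat`), `SatData.abs_vecMul_sub_le` (differences of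
  two box members lie in the doubled virtual box — the START's `V₀`);
* logarithms of the closed forms for the record's budget lines: `log_DΔC`, `ArchSupply.log_WC`, `log_MtV`.

WHAT THIS IS NOT: the packs themselves (`ArchKStepHypD`/`ArchHalfStepHypD`, lp-1) — the `_of_ineqV` constructors follow in the sequel
`ArchG3PackClosedVD` once those texts are in the tree; the inequality (record `ArchG3Rec`, p1); no crux moves.

## References
* Yu. V. Nesterenko, *Linear forms in logarithms of rational numbers*, LNM 1819 (2003) — §3.4 (3.41)–(3.44), §3.5 Lemma 3.11, §4.3 (4.42)–(4.45),
  (4.50). [Nesterenko2003]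
* K. Yu, Acta Math. 211 (2013) — §1.1, Lemma 5.2 (the `p`-adic model; cell files `PadicG3SatData`/`PadicG3SatSupply`). [Yu2013]
-/

noncomputable section

open Finset Polynomial
open scoped Matrix
open Literature.NumberTheory.Transcendental
open Literature.NumberTheory.Transcendental.CW77 (heightProd)
open Literature.NumberTheory.Transcendental.CW77.Setup (Tau tauNorm)
open Summit.ABC.StewartYu.ArchSupply (scaledFeldR WC)
open scoped Nat

namespace Summit.ABC.StewartYu

/-! ### Logarithms of the closed forms -/

namespace ArchSupply

/-- `log WC H ex L₀ Nord ρ = ex·Nord·log 2 + H/e + L₀·(1 + log(1 + 2^{ex}ρ/H))` (`ρ ≥ 0`, `H ≥ 1`). [folklore] -/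
theorem log_WC {H : ℕ} (hH : 1 ≤ H) (ex L₀ Nord : ℕ) {ρ : ℝ} (hρ : 0 ≤ ρ) :
    Real.log (WC H ex L₀ Nord ρ) =
      ((ex * Nord : ℕ) : ℝ) * Real.log 2 + H / Real.exp 1 + L₀ * (1 + Real.log (1 + (2 : ℝ) ^ ex * ρ / H)) := by
  unfold WC
  have hH' : (0 : ℝ) < H := by exact_mod_cast hH
  have h1 : 0 < 1 + (2 : ℝ) ^ ex * ρ / H := by positivity
  rw [Real.log_mul (by positivity) (by positivity), Real.log_pow, Real.log_mul (Real.exp_pos _).ne' (by positivity), Real.log_exp,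
    Real.log_pow, Real.log_mul (Real.exp_pos 1).ne' h1.ne', Real.log_exp]
  ring

end ArchSupply

namespace ArchG3Setup

variable (S : ArchG3Setup) {K : Type*}

/-- `log DΔC Y T′ = T′·(1 + log(1 + Y/T′))` (`Y ≥ 0`) — print's «log(eB) + O(1) per derivative». [cite: Nesterenko2003, §4.2 (4.20)–(4.23); shape only] -/
theorem log_DΔC {Y : ℝ} (hY : 0 ≤ Y) (T' : ℕ) : Real.log (DΔC Y T') = T' * (1 + Real.log (1 + Y / T')) := by
  unfold DΔC
  have h1 : 0 < 1 + Y / T' := by positivity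
  rw [Real.log_pow, Real.log_mul (Real.exp_pos 1).ne' h1.ne', Real.log_exp]

/-! ### The slab-form termwise size `MtV` of the half-step (F = 1) -/

/-- **The slab-form termwise size** `MtV A H ex L₀ T′ N₁ Λb = WC H (ex+1) L₀ T′ N₁ · exp(Λb·N₁ + ΣAₖ/2)` (`Λb = γb + w₀` the pack's slab bound).
[cite: Nesterenko2003, §4.3 (4.44), p. 92; shape only] -/
def MtV (A : Fin S.n → ℝ) (H ex L₀ T' N₁ : ℕ) (Λb : ℝ) : ℝ :=
  WC H (ex + 1) L₀ T' N₁ * Real.exp (Λb * N₁ + (∑ k, A k) / 2)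

/-- `0 ≤ MtV`. [folklore] -/
theorem MtV_nonneg (A : Fin S.n → ℝ) (H ex L₀ T' N₁ : ℕ) (Λb : ℝ) : 0 ≤ S.MtV A H ex L₀ T' N₁ Λb :=
  mul_nonneg (ArchSupply.WC_nonneg H (ex + 1) L₀ T' (Nat.cast_nonneg N₁)) (Real.exp_pos _).le

/-- `log MtV = log WC + Λb·N₁ + ΣAₖ/2`. [folklore] -/
theorem log_MtV (A : Fin S.n → ℝ) {H : ℕ} (hH : 1 ≤ H) (ex L₀ T' N₁ : ℕ) (Λb : ℝ) :
    Real.log (S.MtV A H ex L₀ T' N₁ Λb) = Real.log (WC H (ex + 1) L₀ T' N₁) + (Λb * N₁ + (∑ k, A k) / 2) := by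
  unfold MtV
  have hW : 0 < WC H (ex + 1) L₀ T' N₁ := by
    have hH' : (0 : ℝ) < H := by exact_mod_cast hH
    unfold WC
    positivity
  rw [Real.log_mul hW.ne' (Real.exp_pos _).ne', Real.log_exp]

/-- **The slab-quantified termwise size bound**, uniformly on `|s| ≤ 2N₁ − 1`: for `|Lsum w| ≤ Λb`, `|log αⱼ| ≤ Aⱼ`, `i.1 ≤ L₀`, `a < T′`:
`|(Hasse_a (Δ(·;i.1,H)∘2^{ex+1}·))(s/2) · qEhZ w s| ≤ MtV A H ex L₀ T′ N₁ Λb` (the `hMt` field of the D-half-step pack, F = 1).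
[cite: Nesterenko2003, §4.3 (4.44), p. 92; shape only] -/
theorem abs_hasse_mul_qEhZ_le_MtV {A : Fin S.n → ℝ} (hA : ∀ j, |S.lg j| ≤ A j) {H : ℕ} (hH : 1 ≤ H) (ex : ℕ)
    {L₀ T' N₁ : ℕ} (i : ℕ × K) (hi : i.1 ≤ L₀) {a : ℕ} (ha : a < T') {s : ℤ} (hs : |s| ≤ 2 * (N₁ : ℤ) - 1)
    {w : Fin S.n → ℤ} {Λb : ℝ} (hL : |S.Lsum w| ≤ Λb) :
    |((((hasseDeriv a (scaledFeldR i.1 H (ex + 1))).eval ((s : ℚ) / 2) * S.qEhZ w s : ℚ)) : ℝ)| ≤ S.MtV A H ex L₀ T' N₁ Λb := by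
  have hX : |(((hasseDeriv a (scaledFeldR i.1 H (ex + 1))).eval ((s : ℚ) / 2) : ℚ) : ℝ)| ≤ WC H (ex + 1) L₀ T' N₁ := by
    have h := ArchSupply.norm_hw_le_WC (K := K) hH (ex + 1) i hi ha.le (norm_half_le_of_abs_le hs)
    rw [show ((s : ℂ) / 2) = ((((s : ℚ) / 2 : ℚ)) : ℂ) by push_cast; ring, ArchG3Setup.hw_eval_ratCast,
      ← Complex.ofReal_ratCast, Complex.norm_real, Real.norm_eq_abs] at h
    exact h
  refine (S.abs_hasse_mul_qEhZ_le_slab hA w s hL _ a hX).trans ?_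
  unfold MtV
  have hW0 : 0 ≤ WC H (ex + 1) L₀ T' N₁ := ArchSupply.WC_nonneg H (ex + 1) L₀ T' (Nat.cast_nonneg N₁)
  refine mul_le_mul_of_nonneg_left (Real.exp_le_exp.mpr ?_) hW0
  have hΛ0 : 0 ≤ Λb := (abs_nonneg _).trans hL
  have hs' : |(s : ℝ)| ≤ 2 * (N₁ : ℝ) - 1 := by exact_mod_cast hs
  nlinarith

/-! ### The virtual data at `S(θ)` -/

namespace SatData

variable {S} (F : S.SatData)

/-- `ν` is injective: `μ ᵥ* U = μ′ ᵥ* U ⇒ μ = μ′` (as `U·C = N·1`, `N ≠ 0`) — the `hνinj` of the ξ-output. [folklore] -/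
theorem vecMul_U_injective : Function.Injective fun μ : Fin S.n → ℤ => μ ᵥ* F.U := by
  intro μ μ' h
  have h1 : (F.N : ℤ) • μ = (F.N : ℤ) • μ' := by
    rw [F.N_smul_eq_vecMul_vecMul, F.N_smul_eq_vecMul_vecMul]
    exact congrArg (fun ν : Fin S.n → ℤ => ν ᵥ* F.C) h
  have hN0 : (F.N : ℤ) ≠ 0 := by exact_mod_cast F.hN.ne'
  funext k
  have := congrFun h1 k
  simp only [Pi.smul_apply, smul_eq_mul] at this
  exact mul_left_cancel₀ hN0 this

/-- **Differences of two members of a virtual box lie in the doubled box**: `|ν(μ)ⱼ|, |ν(μ′)ⱼ| ≤ Bvⱼ ⇒ |ν(μ − μ′)ⱼ| ≤ 2Bvⱼ` (the START's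
relative exponents, `V₀`). [folklore] -/
theorem abs_vecMul_sub_le {Bv : Fin S.n → ℕ} {μ μ' : Fin S.n → ℤ} (hμ : ∀ j, |(μ ᵥ* F.U) j| ≤ (Bv j : ℤ))
    (hμ' : ∀ j, |(μ' ᵥ* F.U) j| ≤ (Bv j : ℤ)) (j : Fin S.n) : |((μ - μ') ᵥ* F.U) j| ≤ ((2 * Bv j : ℕ) : ℤ) := by
  rw [Matrix.sub_vecMul, Pi.sub_apply]
  have := hμ j
  have := hμ' j
  calc |(μ ᵥ* F.U) j - (μ' ᵥ* F.U) j| ≤ |(μ ᵥ* F.U) j| + |(μ' ᵥ* F.U) j| := abs_sub _ _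
    _ ≤ ((2 * Bv j : ℕ) : ℤ) := by push_cast; linarith

/-- **The virtual half-step integrality, assembled**: `ν(H)^a · Dhv Bv s` clears `(Hasse_a (Δ(·;ℓ,H)∘2^{ex+1}·))(s/2) · qEhZ μ s` for
`|ν(μ)ⱼ| ≤ Bvⱼ` (the V-quantified `hint` field of the D-half-step pack). [cite: Nesterenko2003, §4.3 (4.42)–(4.43) and (4.50); shape only] -/
theorem exists_int_lcm_pow_mul_Dhv_mul (ℓ : ℕ) {H : ℕ} (hH : 1 ≤ H) (ex a : ℕ) {Bv : Fin S.n → ℕ} {μ : Fin S.n → ℤ}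
    (hμ : ∀ j, |(μ ᵥ* F.U) j| ≤ (Bv j : ℤ)) (s : ℤ) :
    ∃ z : ℤ, (((Nat.lcmUpto H) ^ a * F.Dhv Bv s : ℕ) : ℚ) *
      ((hasseDeriv a (scaledFeldR ℓ H (ex + 1))).eval ((s : ℚ) / 2) * S.qEhZ μ s) = z := by
  obtain ⟨z₀, hz₀⟩ := ArchSupply.exists_int_lcm_pow_mul_hasse_scaledFeldR_half ℓ hH ex a s
  obtain ⟨z₂, hz₂⟩ := F.exists_int_Dhv_mul_qEhZ hμ s
  refine ⟨z₀ * z₂, ?_⟩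
  push_cast at hz₀ ⊢
  calc ((Nat.lcmUpto H : ℚ)) ^ a * (F.Dhv Bv s : ℚ) * ((hasseDeriv a (scaledFeldR ℓ H (ex + 1))).eval ((s : ℚ) / 2) * S.qEhZ μ s)
      = (((Nat.lcmUpto H : ℚ)) ^ a * (hasseDeriv a (scaledFeldR ℓ H (ex + 1))).eval ((s : ℚ) / 2)) *
          ((F.Dhv Bv s : ℚ) * S.qEhZ μ s) := by ring
    _ = (z₀ : ℚ) * (z₂ : ℚ) := by rw [hz₀, hz₂]

/-- `1 ≤ ν(H)^a · Dhv Bv s`. [folklore] -/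
theorem one_le_lcm_pow_mul_Dhv (H a : ℕ) (Bv : Fin S.n → ℕ) (s : ℤ) : 1 ≤ (Nat.lcmUpto H) ^ a * F.Dhv Bv s :=
  one_le_mul (Nat.one_le_pow _ _ (Nat.lcmUpto_pos H)) (F.one_le_Dhv Bv s)

/-- The cost of the assembled half-step denominator: `log(ν(H)^a·Dhv) ≤ (23/20)·a·H + |s|Σ(Bvⱼ/N)Vⱼ + Σ(colUⱼ/N)Vⱼ + 2ΣVⱼ`.
[cite: Nesterenko2003, §4.3 with Lemma 3.11; shape only] -/
theorem log_lcm_pow_mul_Dhv_le {H : ℕ} (a : ℕ) (Bv : Fin S.n → ℕ) (s : ℤ) {V : Fin S.n → ℝ}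
    (hV : ∀ j, Height.logHeight₁ (F.αo j) ≤ V j) :
    Real.log ((((Nat.lcmUpto H) ^ a * F.Dhv Bv s : ℕ)) : ℝ) ≤
      23 / 20 * a * H + (|(s : ℝ)| * ∑ j, ((Bv j : ℝ) / F.N) * V j + ∑ j, ((F.colU j : ℝ) / F.N) * V j + 2 * ∑ j, V j) := by
  have h1 : (0 : ℝ) < (((Nat.lcmUpto H) ^ a : ℕ) : ℝ) := by exact_mod_cast pow_pos (Nat.lcmUpto_pos H) a
  have h2 : (0 : ℝ) < (F.Dhv Bv s : ℝ) := by exact_mod_cast F.one_le_Dhv Bv s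
  rw [Nat.cast_mul, Real.log_mul h1.ne' h2.ne']
  exact add_le_add (ArchSupply.log_lcm_pow_le H a) (F.log_Dhv_le_of_weights Bv s hV)

end SatData

end ArchG3Setup

end Summit.ABC.StewartYu

end
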